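import Literature.AlgebraicGeometry.Motives.AbelianVarietyDihedralOrderEightBrauerRelations
import HarnessLib

/-!
# The Brauer relation lattice of `C_4 × C_2` in full — the last group of order `8`: rank `2`,
# `K(C_4 × C_2) = ℤ·Ind_V ⊕ ℤ·Inf`, both generators coming from `C_2 × C_2` subquotients (Tornehave–Bouc), so
# `Prim(C_4 × C_2) = 0`

Layer A1/A2 of the Hodge foundations lane (`lit-hodgefound`, row A1-20⁺ · A2, seat p03 generation 28, row g28-#8) on
the ALGEBRAIC carrier; completes, with `Motives/AbelianVarietyDihedralOrderEightBrauerRelations` (`D_4`, g28-#2),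
`…QuaternionBrauerRelations` (`Q₈`, g28-#4), `…ElementaryAbelianOrderEightBrauerRelations` (`C_2³`, g28-#7) and the
tree's `brauerRelations_eq_bot_of_isCyclic` (`C_8`: `K = 0`, `Motives/AbelianVarietyBrauerRelationLatticeRank`), the
Brauer relation lattices of ALL FIVE groups of order `8` (CONSUMED: the marks dictionary `indClassFun_one_apply_eq_div`,
`card_conj_mem_bot`, `indClassFun_top_one`, `mem_ker_linearCombination_indClassFun_one_iff`).  Bartel–Dokchitser:
"It is classical that the only abelian groups that have primitive relations are `G = C_p × C_p`" (§1.2); Theorem 4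
(Tornehave–Bouc) (1): relations of abelian `p`-groups come from subquotients `C_p × C_p` with `1 − Σ_C C + p·P`.
Here `G = C_4 × C_2 = ⟨a⟩ × ⟨b⟩` on `Multiplicative (ZMod 4 × ZMod 2)` (`a = (1,0)`, `b = (0,1)`): the EIGHT
subgroups `1, ⟨a²⟩, ⟨b⟩, ⟨a²b⟩, ⟨a⟩, ⟨ab⟩, V = ⟨a², b⟩ ≅ C_2², G` (all normal; marks `8·[g ∈ H]` by `decide`), the
class equations solved (§3: **`a ∈ K` iff `a_1 = −a_{⟨b⟩}`, `a_{⟨a²⟩} = a_{⟨b⟩} − a_{⟨a⟩}`, `a_{⟨a²b⟩} = a_{⟨b⟩}`,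
`a_{⟨ab⟩} = a_{⟨a⟩}`, `a_V = −2a_{⟨b⟩} + a_{⟨a⟩}`, `a_G = −2a_{⟨a⟩}`**), hence **`rank K(C_4 × C_2) = 2`** (the
non-cyclic subgroups `V, G`) with basis **`Ind_V = 1 − ⟨a²⟩ − ⟨b⟩ − ⟨a²b⟩ + 2V`** (Example 3's relation induced
from `V ≅ C_2 × C_2`) and **`Inf = ⟨a²⟩ − ⟨a⟩ − ⟨ab⟩ − V + 2G`** (lifted from `G/⟨a²⟩ ≅ C_2 × C_2`):
`K(C_4 × C_2) = ℤ·Ind_V ⊕ ℤ·Inf`, no primitive relations.  Everything here is PROVED; NO definition, NO named fact.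

## Sources, verbatim

A. Bartel, T. Dokchitser, *Brauer relations in finite groups*, J. Eur. Math. Soc. **17** (2015) (arXiv 1103.2047, held
`paper:arxiv-1103.2047`).  §1.2 (p0004): "It is classical that the only abelian groups that have primitive relations
are `G = C_p × C_p`."  §5 Theorem 4 (p0010): "All Brauer relations in `p`-groups are `ℤ`-linear combinations of ones
lifted from subquotients `P` of the following types: (1) `P ≅ C_p × C_p` with the relation `1 − Σ_C C + p·P`, the
sum taken over all subgroups of order `p`; […]".  §2 (p0006): Induction, Inflation, "the rank of `K(G)` is the
number of conjugacy classes of non-cyclic subgroups", Example 3 ("`Θ = 1 − Σ_C C + pG`").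

## Dictionary and what is proved (namespace `Literature.AlgebraicGeometry.Motives.AbelianVariety`)

Representatives (indices `0…7`): `![1, ⟨a²⟩, ⟨b⟩, ⟨a²b⟩, ⟨a⟩, ⟨ab⟩, V = ⟨a²⟩ ⊔ ⟨b⟩, G]` with `a² = ofAdd (2,0)`,
`b = ofAdd (0,1)`, `a²b = ofAdd (2,1)`, `a = ofAdd (1,0)`, `ab = ofAdd (1,1)`; `𝒦` any `Submodule ℤ (Fin 8 → ℤ)` with
`x ∈ 𝒦 ↔ Σ_i x_i (1_{H_i})^G = 0`; `Ind_V = ![1, -1, -1, -1, 0, 0, 2, 0]`, `Inf = ![0, 1, 0, 0, -1, -1, -1, 2]`.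

* §1 `abelianOrderEight_cases`, `mem_klein_abelianOrderEight_iff`; §2 the marks `card_conj_mem_*_abelianOrderEight`,
  `natCard_subgroups_abelianOrderEight`, **`indClassFun_one_apply_abelianOrderEight`**; §3
  `sum_smul_indClassFun_abelianOrderEight_apply`, **`sum_smul_indClassFun_abelianOrderEight_eq_zero_iff`**,
  `indKlein_mem_abelianOrderEight`, `infKlein_mem_abelianOrderEight`; §4 `mem_brauerRelations_abelianOrderEight_iff`,
  **`eq_combination_of_mem_brauerRelations_abelianOrderEight`** (`x = −x_{⟨b⟩}·Ind_V − x_{⟨a⟩}·Inf`),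
  **`brauerRelations_abelianOrderEight_eq_span`**, `linearIndependent_basis_abelianOrderEight`,
  `ker_linearCombination_indClassFun_one_abelianOrderEight_eq_span`,
  **`finrank_ker_linearCombination_indClassFun_one_abelianOrderEight`** (`= 2`).

Scope: `C_4 × C_2` only; "induced"/"lifted" identified by supports and coefficients; no Kani–Rosen isogeny restated.

## References

* [BartelDokchitser2015] A. Bartel, T. Dokchitser, *Brauer relations in finite groups*, JEMS 17 (2015), §1.2, §2,
  §5 Theorem 4 (1).
-/

noncomputable section

universe u

open CategoryTheory CategoryTheory.Limits
open Literature.RepresentationTheory.FiniteGroups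

namespace Literature.AlgebraicGeometry.Motives

namespace AbelianVariety

/-! ## §1 `C_4 × C_2 = Multiplicative (ZMod 4 × ZMod 2)`: elements, membership in the cyclic subgroups and in `V` -/

section AbelianOrderEightGroup

/-- `|C_4 × C_2| = 8`. [cite: BartelDokchitser2015, §5 Theorem 4 (1)] -/
private theorem card_abelianOrderEight : Fintype.card (Multiplicative (ZMod 4 × ZMod 2)) = 8 := by
  rfl

/-- The eight elements. [cite: BartelDokchitser2015, §1.2 ("the only abelian groups that have primitive relations are G = C_p × C_p")] -/
theorem abelianOrderEight_cases (g : Multiplicative (ZMod 4 × ZMod 2)) :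
    g = 1 ∨ g = (Multiplicative.ofAdd ((0, 1) : ZMod 4 × ZMod 2)) ∨ g = (Multiplicative.ofAdd ((1, 0) : ZMod 4 × ZMod 2)) ∨ g = (Multiplicative.ofAdd ((1, 1) : ZMod 4 × ZMod 2)) ∨ g = (Multiplicative.ofAdd ((2, 0) : ZMod 4 × ZMod 2)) ∨ g = (Multiplicative.ofAdd ((2, 1) : ZMod 4 × ZMod 2)) ∨ g = (Multiplicative.ofAdd ((3, 0) : ZMod 4 × ZMod 2)) ∨ g = (Multiplicative.ofAdd ((3, 1) : ZMod 4 × ZMod 2)) := by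
  revert g
  decide

/-- `x ∈ ⟨g⟩ ↔ x ∈ {g^k : k < orderOf g}` with the orders `2, 2, 2, 4, 4` decided. [folklore] -/
private theorem mem_zpowers_abelianOrderEight_iff (g : Multiplicative (ZMod 4 × ZMod 2)) {n : ℕ} (hn : orderOf g = n) (x : Multiplicative (ZMod 4 × ZMod 2)) :
    x ∈ Subgroup.zpowers g ↔ x ∈ (Finset.range n).image (g ^ ·) := by
  rw [mem_zpowers_iff_mem_range_orderOf, hn]

/-- The orders `2, 2, 2, 4, 4` of `a², b, a²b, a, ab`. [cite: BartelDokchitser2015, §2 Example 3 ("subgroups of order p")] -/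
theorem orderOf_abelianOrderEight :
    orderOf (Multiplicative.ofAdd ((2, 0) : ZMod 4 × ZMod 2)) = 2 ∧ orderOf (Multiplicative.ofAdd ((0, 1) : ZMod 4 × ZMod 2)) = 2 ∧ orderOf (Multiplicative.ofAdd ((2, 1) : ZMod 4 × ZMod 2)) = 2 ∧
      orderOf (Multiplicative.ofAdd ((1, 0) : ZMod 4 × ZMod 2)) = 4 ∧ orderOf (Multiplicative.ofAdd ((1, 1) : ZMod 4 × ZMod 2)) = 4 := by
  refine ⟨?_, ?_, ?_, ?_, ?_⟩
  · rw [orderOf_eq_prime_iff (p := 2)]; decide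
  · rw [orderOf_eq_prime_iff (p := 2)]; decide
  · rw [orderOf_eq_prime_iff (p := 2)]; decide
  · rw [orderOf_eq_iff (by norm_num)]; decide
  · rw [orderOf_eq_iff (by norm_num)]; decide

/-- **`x ∈ V = ⟨a²⟩ ⊔ ⟨b⟩ ↔ x = y·z`, `y ∈ {1, a²}`, `z ∈ {1, b}`.** [cite: BartelDokchitser2015, §5 Theorem 4 (1) ("P ≅ C_p × C_p")] -/
theorem mem_klein_abelianOrderEight_iff (x : Multiplicative (ZMod 4 × ZMod 2)) :
    x ∈ Subgroup.zpowers (Multiplicative.ofAdd ((2, 0) : ZMod 4 × ZMod 2)) ⊔ Subgroup.zpowers (Multiplicative.ofAdd ((0, 1) : ZMod 4 × ZMod 2)) ↔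
      ∃ y ∈ (Finset.range 2).image ((Multiplicative.ofAdd ((2, 0) : ZMod 4 × ZMod 2)) ^ ·), ∃ z ∈ (Finset.range 2).image ((Multiplicative.ofAdd ((0, 1) : ZMod 4 × ZMod 2)) ^ ·), y * z = x := by
  rw [Subgroup.mem_sup]
  simp only [mem_zpowers_abelianOrderEight_iff _ orderOf_abelianOrderEight.1,
    mem_zpowers_abelianOrderEight_iff _ orderOf_abelianOrderEight.2.1]

end AbelianOrderEightGroup

/-! ## §2 The marks (`8·[g ∈ H]`) and the eight permutation characters -/

section AbelianOrderEightMarks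

/-- `|{x : Q x}|` as a filter cardinality. [folklore] -/
private theorem natCard_subtype_eq_card_filter_a8 (Pr : Multiplicative (ZMod 4 × ZMod 2) → Prop) [DecidablePred Pr]
    (Q : Multiplicative (ZMod 4 × ZMod 2) → Prop) (hQP : ∀ x, Q x ↔ Pr x) :
    Nat.card {x : Multiplicative (ZMod 4 × ZMod 2) // Q x} = (Finset.univ.filter Pr).card := by
  rw [← Fintype.card_subtype, ← Nat.card_eq_fintype_card]
  exact Nat.card_congr (Equiv.subtypeEquivRight hQP)

/-- Marks of `⟨a²⟩`: `8·[g ∈ H]`, machine-checked. [cite: BartelDokchitser2015, §2 Example 3; §5 Theorem 4 (1)] -/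
theorem card_conj_mem_sqA_abelianOrderEight (g : Multiplicative (ZMod 4 × ZMod 2)) :
    Nat.card {x : Multiplicative (ZMod 4 × ZMod 2) // x⁻¹ * g * x ∈ Subgroup.zpowers (Multiplicative.ofAdd ((2, 0) : ZMod 4 × ZMod 2))} =
      if g = 1 ∨ g = (Multiplicative.ofAdd ((2, 0) : ZMod 4 × ZMod 2)) then 8 else 0 := by
  classical
  rw [natCard_subtype_eq_card_filter_a8 _ _ fun x ↦ mem_zpowers_abelianOrderEight_iff _ orderOf_abelianOrderEight.1 _]
  revert g
  decide

/-- Marks of `⟨b⟩`: `8·[g ∈ H]`, machine-checked. [cite: BartelDokchitser2015, §2 Example 3; §5 Theorem 4 (1)] -/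
theorem card_conj_mem_b_abelianOrderEight (g : Multiplicative (ZMod 4 × ZMod 2)) :
    Nat.card {x : Multiplicative (ZMod 4 × ZMod 2) // x⁻¹ * g * x ∈ Subgroup.zpowers (Multiplicative.ofAdd ((0, 1) : ZMod 4 × ZMod 2))} =
      if g = 1 ∨ g = (Multiplicative.ofAdd ((0, 1) : ZMod 4 × ZMod 2)) then 8 else 0 := by
  classical
  rw [natCard_subtype_eq_card_filter_a8 _ _ fun x ↦ mem_zpowers_abelianOrderEight_iff _ orderOf_abelianOrderEight.2.1 _]
  revert g
  decide

/-- Marks of `⟨a²b⟩`: `8·[g ∈ H]`, machine-checked. [cite: BartelDokchitser2015, §2 Example 3; §5 Theorem 4 (1)] -/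
theorem card_conj_mem_sqAb_abelianOrderEight (g : Multiplicative (ZMod 4 × ZMod 2)) :
    Nat.card {x : Multiplicative (ZMod 4 × ZMod 2) // x⁻¹ * g * x ∈ Subgroup.zpowers (Multiplicative.ofAdd ((2, 1) : ZMod 4 × ZMod 2))} =
      if g = 1 ∨ g = (Multiplicative.ofAdd ((2, 1) : ZMod 4 × ZMod 2)) then 8 else 0 := by
  classical
  rw [natCard_subtype_eq_card_filter_a8 _ _ fun x ↦ mem_zpowers_abelianOrderEight_iff _ orderOf_abelianOrderEight.2.2.1 _]
  revert g
  decide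

/-- Marks of `⟨a⟩`: `8·[g ∈ H]`, machine-checked. [cite: BartelDokchitser2015, §2 Example 3; §5 Theorem 4 (1)] -/
theorem card_conj_mem_a_abelianOrderEight (g : Multiplicative (ZMod 4 × ZMod 2)) :
    Nat.card {x : Multiplicative (ZMod 4 × ZMod 2) // x⁻¹ * g * x ∈ Subgroup.zpowers (Multiplicative.ofAdd ((1, 0) : ZMod 4 × ZMod 2))} =
      if g = 1 ∨ g = (Multiplicative.ofAdd ((1, 0) : ZMod 4 × ZMod 2)) ∨ g = (Multiplicative.ofAdd ((2, 0) : ZMod 4 × ZMod 2)) ∨ g = (Multiplicative.ofAdd ((3, 0) : ZMod 4 × ZMod 2)) then 8 else 0 := by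
  classical
  rw [natCard_subtype_eq_card_filter_a8 _ _ fun x ↦ mem_zpowers_abelianOrderEight_iff _ orderOf_abelianOrderEight.2.2.2.1 _]
  revert g
  decide

/-- Marks of `⟨ab⟩`: `8·[g ∈ H]`, machine-checked. [cite: BartelDokchitser2015, §2 Example 3; §5 Theorem 4 (1)] -/
theorem card_conj_mem_ab_abelianOrderEight (g : Multiplicative (ZMod 4 × ZMod 2)) :
    Nat.card {x : Multiplicative (ZMod 4 × ZMod 2) // x⁻¹ * g * x ∈ Subgroup.zpowers (Multiplicative.ofAdd ((1, 1) : ZMod 4 × ZMod 2))} =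
      if g = 1 ∨ g = (Multiplicative.ofAdd ((1, 1) : ZMod 4 × ZMod 2)) ∨ g = (Multiplicative.ofAdd ((2, 0) : ZMod 4 × ZMod 2)) ∨ g = (Multiplicative.ofAdd ((3, 1) : ZMod 4 × ZMod 2)) then 8 else 0 := by
  classical
  rw [natCard_subtype_eq_card_filter_a8 _ _ fun x ↦ mem_zpowers_abelianOrderEight_iff _ orderOf_abelianOrderEight.2.2.2.2 _]
  revert g
  decide

/-- Marks of `V = ⟨a², b⟩`: `8·[g ∈ V]`, machine-checked. [cite: BartelDokchitser2015, §5 Theorem 4 (1) ("P ≅ C_p × C_p")] -/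
theorem card_conj_mem_klein_abelianOrderEight (g : Multiplicative (ZMod 4 × ZMod 2)) :
    Nat.card {x : Multiplicative (ZMod 4 × ZMod 2) // x⁻¹ * g * x ∈ Subgroup.zpowers (Multiplicative.ofAdd ((2, 0) : ZMod 4 × ZMod 2)) ⊔ Subgroup.zpowers (Multiplicative.ofAdd ((0, 1) : ZMod 4 × ZMod 2))} =
      if g = 1 ∨ g = (Multiplicative.ofAdd ((2, 0) : ZMod 4 × ZMod 2)) ∨ g = (Multiplicative.ofAdd ((0, 1) : ZMod 4 × ZMod 2)) ∨ g = (Multiplicative.ofAdd ((2, 1) : ZMod 4 × ZMod 2)) then 8 else 0 := by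
  classical
  rw [natCard_subtype_eq_card_filter_a8 _ _ fun x ↦ mem_klein_abelianOrderEight_iff _]
  revert g
  decide

/-- The orders `2, 2, 2, 4, 4, 4` of `⟨a²⟩, ⟨b⟩, ⟨a²b⟩, ⟨a⟩, ⟨ab⟩, V`. [cite: BartelDokchitser2015, §2 Example 3; §5 Theorem 4 (1)] -/
theorem natCard_subgroups_abelianOrderEight :
    Nat.card (Subgroup.zpowers (Multiplicative.ofAdd ((2, 0) : ZMod 4 × ZMod 2))) = 2 ∧ Nat.card (Subgroup.zpowers (Multiplicative.ofAdd ((0, 1) : ZMod 4 × ZMod 2))) = 2 ∧ Nat.card (Subgroup.zpowers (Multiplicative.ofAdd ((2, 1) : ZMod 4 × ZMod 2))) = 2 ∧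
      Nat.card (Subgroup.zpowers (Multiplicative.ofAdd ((1, 0) : ZMod 4 × ZMod 2))) = 4 ∧ Nat.card (Subgroup.zpowers (Multiplicative.ofAdd ((1, 1) : ZMod 4 × ZMod 2))) = 4 ∧ Nat.card ↥(Subgroup.zpowers (Multiplicative.ofAdd ((2, 0) : ZMod 4 × ZMod 2)) ⊔ Subgroup.zpowers (Multiplicative.ofAdd ((0, 1) : ZMod 4 × ZMod 2))) = 4 := by
  classical
  obtain ⟨o1, o2, o3, o4, o5⟩ := orderOf_abelianOrderEight
  refine ⟨?_, ?_, ?_, ?_, ?_, ?_⟩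
  · rw [Nat.card_zpowers, o1]
  · rw [Nat.card_zpowers, o2]
  · rw [Nat.card_zpowers, o3]
  · rw [Nat.card_zpowers, o4]
  · rw [Nat.card_zpowers, o5]
  · exact (natCard_subtype_eq_card_filter_a8 _ _ mem_klein_abelianOrderEight_iff).trans (by decide)

/-- **The eight permutation characters `(1_H)^G = [G:H]·1_H` as explicit functions on `C_4 × C_2`.**
[cite: BartelDokchitser2015, §1.1 ("Θ ∈ K(G) ⟺ Σ_i n_i Ind 1_{H_i} = 0"); §2 Example 3] -/
theorem indClassFun_one_apply_abelianOrderEight (g : Multiplicative (ZMod 4 × ZMod 2)) :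
    indClassFun (⊥ : Subgroup (Multiplicative (ZMod 4 × ZMod 2))) 1 g = (if g = 1 then (8 : ℂ) else 0) ∧
    indClassFun (Subgroup.zpowers (Multiplicative.ofAdd ((2, 0) : ZMod 4 × ZMod 2))) 1 g = (if g = 1 ∨ g = (Multiplicative.ofAdd ((2, 0) : ZMod 4 × ZMod 2)) then (4 : ℂ) else 0) ∧
    indClassFun (Subgroup.zpowers (Multiplicative.ofAdd ((0, 1) : ZMod 4 × ZMod 2))) 1 g = (if g = 1 ∨ g = (Multiplicative.ofAdd ((0, 1) : ZMod 4 × ZMod 2)) then (4 : ℂ) else 0) ∧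
    indClassFun (Subgroup.zpowers (Multiplicative.ofAdd ((2, 1) : ZMod 4 × ZMod 2))) 1 g = (if g = 1 ∨ g = (Multiplicative.ofAdd ((2, 1) : ZMod 4 × ZMod 2)) then (4 : ℂ) else 0) ∧
    indClassFun (Subgroup.zpowers (Multiplicative.ofAdd ((1, 0) : ZMod 4 × ZMod 2))) 1 g =
      (if g = 1 ∨ g = (Multiplicative.ofAdd ((1, 0) : ZMod 4 × ZMod 2)) ∨ g = (Multiplicative.ofAdd ((2, 0) : ZMod 4 × ZMod 2)) ∨ g = (Multiplicative.ofAdd ((3, 0) : ZMod 4 × ZMod 2)) then (2 : ℂ) else 0) ∧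
    indClassFun (Subgroup.zpowers (Multiplicative.ofAdd ((1, 1) : ZMod 4 × ZMod 2))) 1 g =
      (if g = 1 ∨ g = (Multiplicative.ofAdd ((1, 1) : ZMod 4 × ZMod 2)) ∨ g = (Multiplicative.ofAdd ((2, 0) : ZMod 4 × ZMod 2)) ∨ g = (Multiplicative.ofAdd ((3, 1) : ZMod 4 × ZMod 2)) then (2 : ℂ) else 0) ∧
    indClassFun (Subgroup.zpowers (Multiplicative.ofAdd ((2, 0) : ZMod 4 × ZMod 2)) ⊔ Subgroup.zpowers (Multiplicative.ofAdd ((0, 1) : ZMod 4 × ZMod 2))) 1 g =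
      (if g = 1 ∨ g = (Multiplicative.ofAdd ((2, 0) : ZMod 4 × ZMod 2)) ∨ g = (Multiplicative.ofAdd ((0, 1) : ZMod 4 × ZMod 2)) ∨ g = (Multiplicative.ofAdd ((2, 1) : ZMod 4 × ZMod 2)) then (2 : ℂ) else 0) ∧
    indClassFun (⊤ : Subgroup (Multiplicative (ZMod 4 × ZMod 2))) 1 g = 1 := by
  classical
  obtain ⟨c1, c2, c3, c4, c5, c6⟩ := natCard_subgroups_abelianOrderEight
  refine ⟨?_, ?_, ?_, ?_, ?_, ?_, ?_, ?_⟩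
  · rw [indClassFun_one_apply_eq_div, card_conj_mem_bot, Subgroup.card_bot, card_abelianOrderEight]
    split_ifs <;> norm_num
  · rw [indClassFun_one_apply_eq_div, card_conj_mem_sqA_abelianOrderEight, c1]
    split_ifs <;> norm_num
  · rw [indClassFun_one_apply_eq_div, card_conj_mem_b_abelianOrderEight, c2]
    split_ifs <;> norm_num
  · rw [indClassFun_one_apply_eq_div, card_conj_mem_sqAb_abelianOrderEight, c3]
    split_ifs <;> norm_num
  · rw [indClassFun_one_apply_eq_div, card_conj_mem_a_abelianOrderEight, c4]
    split_ifs <;> norm_num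
  · rw [indClassFun_one_apply_eq_div, card_conj_mem_ab_abelianOrderEight, c5]
    split_ifs <;> norm_num
  · rw [indClassFun_one_apply_eq_div, card_conj_mem_klein_abelianOrderEight, c6]
    split_ifs <;> norm_num
  · rw [indClassFun_top_one, Pi.one_apply]

end AbelianOrderEightMarks

/-! ## §3 The class equations and the two Tornehave–Bouc generators -/

section AbelianOrderEightRelations

/-- The signed-sum test on the eight subgroups, pointwise. [cite: BartelDokchitser2015, §1.1] -/
theorem sum_smul_indClassFun_abelianOrderEight_apply (a : Fin 8 → ℤ) (g : Multiplicative (ZMod 4 × ZMod 2)) :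
    (∑ i : Fin 8, (a i : ℂ) • indClassFun ((![⊥,
        Subgroup.zpowers (Multiplicative.ofAdd ((2, 0) : ZMod 4 × ZMod 2)),
        Subgroup.zpowers (Multiplicative.ofAdd ((0, 1) : ZMod 4 × ZMod 2)),
        Subgroup.zpowers (Multiplicative.ofAdd ((2, 1) : ZMod 4 × ZMod 2)),
        Subgroup.zpowers (Multiplicative.ofAdd ((1, 0) : ZMod 4 × ZMod 2)),
        Subgroup.zpowers (Multiplicative.ofAdd ((1, 1) : ZMod 4 × ZMod 2)),
        Subgroup.zpowers (Multiplicative.ofAdd ((2, 0) : ZMod 4 × ZMod 2)) ⊔ Subgroup.zpowers (Multiplicative.ofAdd ((0, 1) : ZMod 4 × ZMod 2)),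
        ⊤] :
        Fin 8 → Subgroup (Multiplicative (ZMod 4 × ZMod 2))) i) 1) g =
      a 0 * (if g = 1 then (8 : ℂ) else 0) +
      a 1 * (if g = 1 ∨ g = (Multiplicative.ofAdd ((2, 0) : ZMod 4 × ZMod 2)) then (4 : ℂ) else 0) +
      a 2 * (if g = 1 ∨ g = (Multiplicative.ofAdd ((0, 1) : ZMod 4 × ZMod 2)) then (4 : ℂ) else 0) +
      a 3 * (if g = 1 ∨ g = (Multiplicative.ofAdd ((2, 1) : ZMod 4 × ZMod 2)) then (4 : ℂ) else 0) +
      a 4 * (if g = 1 ∨ g = (Multiplicative.ofAdd ((1, 0) : ZMod 4 × ZMod 2)) ∨ g = (Multiplicative.ofAdd ((2, 0) : ZMod 4 × ZMod 2)) ∨ g = (Multiplicative.ofAdd ((3, 0) : ZMod 4 × ZMod 2)) then (2 : ℂ) else 0) +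
      a 5 * (if g = 1 ∨ g = (Multiplicative.ofAdd ((1, 1) : ZMod 4 × ZMod 2)) ∨ g = (Multiplicative.ofAdd ((2, 0) : ZMod 4 × ZMod 2)) ∨ g = (Multiplicative.ofAdd ((3, 1) : ZMod 4 × ZMod 2)) then (2 : ℂ) else 0) +
      a 6 * (if g = 1 ∨ g = (Multiplicative.ofAdd ((2, 0) : ZMod 4 × ZMod 2)) ∨ g = (Multiplicative.ofAdd ((0, 1) : ZMod 4 × ZMod 2)) ∨ g = (Multiplicative.ofAdd ((2, 1) : ZMod 4 × ZMod 2)) then (2 : ℂ) else 0) + a 7 := by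
  obtain ⟨h0, h1, h2, h3, h4, h5, h6, h7⟩ := indClassFun_one_apply_abelianOrderEight g
  simp only [Finset.sum_apply, Pi.smul_apply, smul_eq_mul, Fin.sum_univ_eight]
  show (a 0 : ℂ) * indClassFun ((⊥ : Subgroup (Multiplicative (ZMod 4 × ZMod 2)))) 1 g +
      (a 1 : ℂ) * indClassFun (Subgroup.zpowers (Multiplicative.ofAdd ((2, 0) : ZMod 4 × ZMod 2))) 1 g +
      (a 2 : ℂ) * indClassFun (Subgroup.zpowers (Multiplicative.ofAdd ((0, 1) : ZMod 4 × ZMod 2))) 1 g +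
      (a 3 : ℂ) * indClassFun (Subgroup.zpowers (Multiplicative.ofAdd ((2, 1) : ZMod 4 × ZMod 2))) 1 g +
      (a 4 : ℂ) * indClassFun (Subgroup.zpowers (Multiplicative.ofAdd ((1, 0) : ZMod 4 × ZMod 2))) 1 g +
      (a 5 : ℂ) * indClassFun (Subgroup.zpowers (Multiplicative.ofAdd ((1, 1) : ZMod 4 × ZMod 2))) 1 g +
      (a 6 : ℂ) * indClassFun (Subgroup.zpowers (Multiplicative.ofAdd ((2, 0) : ZMod 4 × ZMod 2)) ⊔ Subgroup.zpowers (Multiplicative.ofAdd ((0, 1) : ZMod 4 × ZMod 2))) 1 g +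
      (a 7 : ℂ) * indClassFun ((⊤ : Subgroup (Multiplicative (ZMod 4 × ZMod 2)))) 1 g = _
  rw [h0, h1, h2, h3, h4, h5, h6, h7, mul_one]

/-- **The Brauer relations of `C_4 × C_2`**: `a ∈ K` iff `a_1 = −a_{⟨b⟩}`, `a_{⟨a²⟩} = a_{⟨b⟩} − a_{⟨a⟩}`,
`a_{⟨a²b⟩} = a_{⟨b⟩}`, `a_{⟨ab⟩} = a_{⟨a⟩}`, `a_V = −2a_{⟨b⟩} + a_{⟨a⟩}`, `a_G = −2a_{⟨a⟩}` (free `a_{⟨b⟩}, a_{⟨a⟩}`: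
rank `2`). [cite: BartelDokchitser2015, §1.1; §2 ("rank … non-cyclic subgroups")] -/
theorem sum_smul_indClassFun_abelianOrderEight_eq_zero_iff (a : Fin 8 → ℤ) :
    ∑ i : Fin 8, (a i : ℂ) • indClassFun ((![⊥,
        Subgroup.zpowers (Multiplicative.ofAdd ((2, 0) : ZMod 4 × ZMod 2)),
        Subgroup.zpowers (Multiplicative.ofAdd ((0, 1) : ZMod 4 × ZMod 2)),
        Subgroup.zpowers (Multiplicative.ofAdd ((2, 1) : ZMod 4 × ZMod 2)),
        Subgroup.zpowers (Multiplicative.ofAdd ((1, 0) : ZMod 4 × ZMod 2)),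
        Subgroup.zpowers (Multiplicative.ofAdd ((1, 1) : ZMod 4 × ZMod 2)),
        Subgroup.zpowers (Multiplicative.ofAdd ((2, 0) : ZMod 4 × ZMod 2)) ⊔ Subgroup.zpowers (Multiplicative.ofAdd ((0, 1) : ZMod 4 × ZMod 2)),
        ⊤] :
        Fin 8 → Subgroup (Multiplicative (ZMod 4 × ZMod 2))) i) 1 = 0 ↔
      a 0 = -a 2 ∧ a 1 = a 2 - a 4 ∧ a 3 = a 2 ∧ a 5 = a 4 ∧ a 6 = -2 * a 2 + a 4 ∧ a 7 = -2 * a 4 := by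
  constructor
  · intro h
    have e := fun g ↦ (sum_smul_indClassFun_abelianOrderEight_apply a g).symm.trans (congr_fun h g)
    have e0 := e 1
    have e1 := e (Multiplicative.ofAdd ((2, 0) : ZMod 4 × ZMod 2))
    have e2 := e (Multiplicative.ofAdd ((0, 1) : ZMod 4 × ZMod 2))
    have e3 := e (Multiplicative.ofAdd ((2, 1) : ZMod 4 × ZMod 2))
    have e4 := e (Multiplicative.ofAdd ((1, 0) : ZMod 4 × ZMod 2))
    have e5 := e (Multiplicative.ofAdd ((1, 1) : ZMod 4 × ZMod 2))
    simp (config := { decide := true }) only [Pi.zero_apply, if_true, if_false, mul_zero, add_zero] at e0 e1 e2 e3 e4 e5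
    have i0 : ((8 * a 0 + 4 * a 1 + 4 * a 2 + 4 * a 3 + 2 * a 4 + 2 * a 5 + 2 * a 6 + a 7 : ℤ) : ℂ) = 0 := by
      push_cast; linear_combination e0
    have i1 : ((4 * a 1 + 2 * a 4 + 2 * a 5 + 2 * a 6 + a 7 : ℤ) : ℂ) = 0 := by push_cast; linear_combination e1
    have i2 : ((4 * a 2 + 2 * a 6 + a 7 : ℤ) : ℂ) = 0 := by push_cast; linear_combination e2
    have i3 : ((4 * a 3 + 2 * a 6 + a 7 : ℤ) : ℂ) = 0 := by push_cast; linear_combination e3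
    have i4 : ((2 * a 4 + a 7 : ℤ) : ℂ) = 0 := by push_cast; linear_combination e4
    have i5 : ((2 * a 5 + a 7 : ℤ) : ℂ) = 0 := by push_cast; linear_combination e5
    norm_cast at i0 i1 i2 i3 i4 i5
    omega
  · rintro ⟨h0, h1, h3, h5, h6, h7⟩
    funext g
    rw [sum_smul_indClassFun_abelianOrderEight_apply, Pi.zero_apply, h0, h1, h3, h5, h6, h7]
    push_cast
    rcases abelianOrderEight_cases g with rfl | rfl | rfl | rfl | rfl | rfl | rfl | rfl <;>
    · simp (config := { decide := true }) only [if_true, if_false]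
      ring

/-- **`Ind_V = 1 − ⟨a²⟩ − ⟨b⟩ − ⟨a²b⟩ + 2V`, Example 3's relation INDUCED from `V ≅ C_2 × C_2`, is a relation.**
[cite: BartelDokchitser2015, §2 (Induction; Example 3); §5 Theorem 4 (1)] -/
theorem indKlein_mem_abelianOrderEight :
    ∑ i : Fin 8, (((![1, -1, -1, -1, 0, 0, 2, 0] : Fin 8 → ℤ) i : ℤ) : ℂ) • indClassFun ((![⊥,
        Subgroup.zpowers (Multiplicative.ofAdd ((2, 0) : ZMod 4 × ZMod 2)),
        Subgroup.zpowers (Multiplicative.ofAdd ((0, 1) : ZMod 4 × ZMod 2)),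
        Subgroup.zpowers (Multiplicative.ofAdd ((2, 1) : ZMod 4 × ZMod 2)),
        Subgroup.zpowers (Multiplicative.ofAdd ((1, 0) : ZMod 4 × ZMod 2)),
        Subgroup.zpowers (Multiplicative.ofAdd ((1, 1) : ZMod 4 × ZMod 2)),
        Subgroup.zpowers (Multiplicative.ofAdd ((2, 0) : ZMod 4 × ZMod 2)) ⊔ Subgroup.zpowers (Multiplicative.ofAdd ((0, 1) : ZMod 4 × ZMod 2)),
        ⊤] :
        Fin 8 → Subgroup (Multiplicative (ZMod 4 × ZMod 2))) i) 1 = 0 :=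
  (sum_smul_indClassFun_abelianOrderEight_eq_zero_iff _).2 (by simp)

/-- **`Inf = ⟨a²⟩ − ⟨a⟩ − ⟨ab⟩ − V + 2G`, Example 3's relation LIFTED from `G/⟨a²⟩ ≅ C_2 × C_2`, is a relation.**
[cite: BartelDokchitser2015, §2 (Inflation; Example 3); §5 Theorem 4 (1)] -/
theorem infKlein_mem_abelianOrderEight :
    ∑ i : Fin 8, (((![0, 1, 0, 0, -1, -1, -1, 2] : Fin 8 → ℤ) i : ℤ) : ℂ) • indClassFun ((![⊥,
        Subgroup.zpowers (Multiplicative.ofAdd ((2, 0) : ZMod 4 × ZMod 2)),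
        Subgroup.zpowers (Multiplicative.ofAdd ((0, 1) : ZMod 4 × ZMod 2)),
        Subgroup.zpowers (Multiplicative.ofAdd ((2, 1) : ZMod 4 × ZMod 2)),
        Subgroup.zpowers (Multiplicative.ofAdd ((1, 0) : ZMod 4 × ZMod 2)),
        Subgroup.zpowers (Multiplicative.ofAdd ((1, 1) : ZMod 4 × ZMod 2)),
        Subgroup.zpowers (Multiplicative.ofAdd ((2, 0) : ZMod 4 × ZMod 2)) ⊔ Subgroup.zpowers (Multiplicative.ofAdd ((0, 1) : ZMod 4 × ZMod 2)),
        ⊤] :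
        Fin 8 → Subgroup (Multiplicative (ZMod 4 × ZMod 2))) i) 1 = 0 :=
  (sum_smul_indClassFun_abelianOrderEight_eq_zero_iff _).2 (by simp)

end AbelianOrderEightRelations

/-! ## §4 `K(C_4 × C_2) = ℤ·Ind_V ⊕ ℤ·Inf`: rank `2`, no primitive relations -/

section AbelianOrderEightLattice

variable (𝒦 : Submodule ℤ (Fin 8 → ℤ))
  (h𝒦 : ∀ a : Fin 8 → ℤ, a ∈ 𝒦 ↔ ∑ i : Fin 8, (a i : ℂ) • indClassFun ((![⊥,
        Subgroup.zpowers (Multiplicative.ofAdd ((2, 0) : ZMod 4 × ZMod 2)),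
        Subgroup.zpowers (Multiplicative.ofAdd ((0, 1) : ZMod 4 × ZMod 2)),
        Subgroup.zpowers (Multiplicative.ofAdd ((2, 1) : ZMod 4 × ZMod 2)),
        Subgroup.zpowers (Multiplicative.ofAdd ((1, 0) : ZMod 4 × ZMod 2)),
        Subgroup.zpowers (Multiplicative.ofAdd ((1, 1) : ZMod 4 × ZMod 2)),
        Subgroup.zpowers (Multiplicative.ofAdd ((2, 0) : ZMod 4 × ZMod 2)) ⊔ Subgroup.zpowers (Multiplicative.ofAdd ((0, 1) : ZMod 4 × ZMod 2)),
        ⊤] :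
        Fin 8 → Subgroup (Multiplicative (ZMod 4 × ZMod 2))) i) 1 = 0)
include h𝒦

/-- **Membership in `K(C_4 × C_2)` in coordinates.** [cite: BartelDokchitser2015, §1.1; §2] -/
theorem mem_brauerRelations_abelianOrderEight_iff (a : Fin 8 → ℤ) :
    a ∈ 𝒦 ↔ a 0 = -a 2 ∧ a 1 = a 2 - a 4 ∧ a 3 = a 2 ∧ a 5 = a 4 ∧ a 6 = -2 * a 2 + a 4 ∧ a 7 = -2 * a 4 :=
  (h𝒦 a).trans (sum_smul_indClassFun_abelianOrderEight_eq_zero_iff a)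

/-- `Ind_V, Inf ∈ K(C_4 × C_2)`. [cite: BartelDokchitser2015, §5 Theorem 4 (1)] -/
theorem generators_mem_brauerRelations_abelianOrderEight :
    (![1, -1, -1, -1, 0, 0, 2, 0] : Fin 8 → ℤ) ∈ 𝒦 ∧ (![0, 1, 0, 0, -1, -1, -1, 2] : Fin 8 → ℤ) ∈ 𝒦 :=
  ⟨(h𝒦 _).2 indKlein_mem_abelianOrderEight, (h𝒦 _).2 infKlein_mem_abelianOrderEight⟩

/-- **Every relation of `C_4 × C_2` is `−a_{⟨b⟩}·Ind_V − a_{⟨a⟩}·Inf`.** [cite: BartelDokchitser2015, §5 Theorem 4 (1); §1.2] -/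
theorem eq_combination_of_mem_brauerRelations_abelianOrderEight {a : Fin 8 → ℤ} (ha : a ∈ 𝒦) :
    a = (-a 2) • (![1, -1, -1, -1, 0, 0, 2, 0] : Fin 8 → ℤ) + (-a 4) • (![0, 1, 0, 0, -1, -1, -1, 2] : Fin 8 → ℤ) := by
  obtain ⟨h0, h1, h3, h5, h6, h7⟩ := (mem_brauerRelations_abelianOrderEight_iff 𝒦 h𝒦 a).1 ha
  funext i
  fin_cases i <;> simp <;> omega

/-- **`K(C_4 × C_2) = ℤ·Ind_V ⊕ ℤ·Inf`** — both generators come from `C_2 × C_2` subquotients: NO primitive relations.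
[cite: BartelDokchitser2015, §5 Theorem 4 (1); §1.2 ("the only abelian groups that have primitive relations are G = C_p × C_p")] -/
theorem brauerRelations_abelianOrderEight_eq_span :
    𝒦 = Submodule.span ℤ {(![1, -1, -1, -1, 0, 0, 2, 0] : Fin 8 → ℤ), ![0, 1, 0, 0, -1, -1, -1, 2]} := by
  obtain ⟨m1, m2⟩ := generators_mem_brauerRelations_abelianOrderEight 𝒦 h𝒦
  refine le_antisymm (fun a ha ↦ ?_) (Submodule.span_le.2 ?_)
  · rw [eq_combination_of_mem_brauerRelations_abelianOrderEight 𝒦 h𝒦 ha]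
    exact Submodule.add_mem _ (Submodule.smul_mem _ _ (Submodule.subset_span (by simp)))
      (Submodule.smul_mem _ _ (Submodule.subset_span (by simp)))
  · rintro v (rfl | rfl)
    exacts [m1, m2]

omit h𝒦 in
/-- `Ind_V, Inf` are linearly independent. [cite: BartelDokchitser2015, §2 ("clearly linearly independent")] -/
theorem linearIndependent_basis_abelianOrderEight :
    LinearIndependent ℤ (![(![1, -1, -1, -1, 0, 0, 2, 0] : Fin 8 → ℤ), ![0, 1, 0, 0, -1, -1, -1, 2]] : Fin 2 → Fin 8 → ℤ) := by
  rw [Fintype.linearIndependent_iff]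
  intro c hc i
  have e0 := congr_fun hc 0
  have e7 := congr_fun hc 7
  simp [Fin.sum_univ_two] at e0 e7
  fin_cases i <;> simp <;> omega

omit h𝒦 in
/-- The canonical lattice `K(C_4 × C_2) = ker(a ↦ Σ_i a_i (1_{H_i})^G) = ℤ·Ind_V ⊕ ℤ·Inf`. [cite: BartelDokchitser2015, §5 Theorem 4 (1)] -/
theorem ker_linearCombination_indClassFun_one_abelianOrderEight_eq_span :
    LinearMap.ker (Fintype.linearCombination ℤ fun i : Fin 8 ↦ indClassFun ((![⊥,
        Subgroup.zpowers (Multiplicative.ofAdd ((2, 0) : ZMod 4 × ZMod 2)),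
        Subgroup.zpowers (Multiplicative.ofAdd ((0, 1) : ZMod 4 × ZMod 2)),
        Subgroup.zpowers (Multiplicative.ofAdd ((2, 1) : ZMod 4 × ZMod 2)),
        Subgroup.zpowers (Multiplicative.ofAdd ((1, 0) : ZMod 4 × ZMod 2)),
        Subgroup.zpowers (Multiplicative.ofAdd ((1, 1) : ZMod 4 × ZMod 2)),
        Subgroup.zpowers (Multiplicative.ofAdd ((2, 0) : ZMod 4 × ZMod 2)) ⊔ Subgroup.zpowers (Multiplicative.ofAdd ((0, 1) : ZMod 4 × ZMod 2)),
        ⊤] :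
        Fin 8 → Subgroup (Multiplicative (ZMod 4 × ZMod 2))) i) 1) =
      Submodule.span ℤ {(![1, -1, -1, -1, 0, 0, 2, 0] : Fin 8 → ℤ), ![0, 1, 0, 0, -1, -1, -1, 2]} :=
  brauerRelations_abelianOrderEight_eq_span _ (mem_ker_linearCombination_indClassFun_one_iff _)

omit h𝒦 in
/-- **`rank K(C_4 × C_2) = 2`** (on the canonical lattice) — the non-cyclic subgroups `V, G`. [cite: BartelDokchitser2015, §2] -/
theorem finrank_ker_linearCombination_indClassFun_one_abelianOrderEight :
    Module.finrank ℤ (LinearMap.ker (Fintype.linearCombination ℤ fun i : Fin 8 ↦ indClassFun ((![⊥,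
        Subgroup.zpowers (Multiplicative.ofAdd ((2, 0) : ZMod 4 × ZMod 2)),
        Subgroup.zpowers (Multiplicative.ofAdd ((0, 1) : ZMod 4 × ZMod 2)),
        Subgroup.zpowers (Multiplicative.ofAdd ((2, 1) : ZMod 4 × ZMod 2)),
        Subgroup.zpowers (Multiplicative.ofAdd ((1, 0) : ZMod 4 × ZMod 2)),
        Subgroup.zpowers (Multiplicative.ofAdd ((1, 1) : ZMod 4 × ZMod 2)),
        Subgroup.zpowers (Multiplicative.ofAdd ((2, 0) : ZMod 4 × ZMod 2)) ⊔ Subgroup.zpowers (Multiplicative.ofAdd ((0, 1) : ZMod 4 × ZMod 2)),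
        ⊤] :
        Fin 8 → Subgroup (Multiplicative (ZMod 4 × ZMod 2))) i) 1)) = 2 := by
  rw [ker_linearCombination_indClassFun_one_abelianOrderEight_eq_span]
  have h := linearIndependent_basis_abelianOrderEight
  rw [show ({(![1, -1, -1, -1, 0, 0, 2, 0] : Fin 8 → ℤ), ![0, 1, 0, 0, -1, -1, -1, 2]} : Set (Fin 8 → ℤ)) =
      Set.range (![(![1, -1, -1, -1, 0, 0, 2, 0] : Fin 8 → ℤ), ![0, 1, 0, 0, -1, -1, -1, 2]] : Fin 2 → Fin 8 → ℤ) by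
    ext v
    simp only [Set.mem_insert_iff, Set.mem_singleton_iff, Set.mem_range]
    constructor
    · rintro (rfl | rfl)
      exacts [⟨0, rfl⟩, ⟨1, rfl⟩]
    · rintro ⟨i, rfl⟩
      fin_cases i <;> simp]
  rw [finrank_span_eq_card h, Fintype.card_fin]

end AbelianOrderEightLattice

end AbelianVariety

end Literature.AlgebraicGeometry.Motives
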